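import Mathlib.Analysis.SpecialFunctions.Integrals.Basic
import Mathlib.Analysis.SpecialFunctions.Trigonometric.Bounds
import Literature.Analysis.Calculus.SmoothCutoff

/-!
# Route `BECDyadicChaining` — crux `BaseCoherentMass` (stmt-AtomisticToContinuum-13193), stub
`stub_freeUpperBound`, auxiliary file: the one-dimensional cut-off sine profile

Helper for the registered stub `stub_freeUpperBound` (the sharp free Dirichlet upper bound
`E₀(0, N, L) ≤ 3π²N/L²`) of the line `registered` of the crux
`Summit.AtomisticToContinuum.BoseEinsteinCondensation.Theses.BECDyadicChaining.BaseCoherentMass`.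
The sine mode `sin(πt/L)` of the interval `(0, L)` is not admissible for the tree's `C¹` Dirichlet
trial states (its zero extension is not `C¹` at the end points), so we cut it off smoothly near the
end points: `f(t) = sin(πt/L) · cutoff_R((t - L/2)/ε)` with the plateau cut-off of
`Literature.Analysis.Calculus.SmoothCutoff` (`= 1` on `[ε, L - ε]`, `= 0` off `(0, L)`, `|cutoff'| ≤ D`
uniformly). The registered sub-goal `stub_freeUpperBound_profile` states: for every `L > 0` and
`η > 0` there is a `C¹` function `f : ℝ → ℝ` vanishing off `(0, L)` with
`0 < ∫ f² < ∞` and `∫ f'² ≤ (π²/L² + η) ∫ f²` (Rayleigh quotient `↓ π²/L²`).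

Proof: `f' = (π/L) cos(πt/L) q + sin(πt/L) q'`; Young `(a+b)² ≤ (1+τ)a² + (1+τ⁻¹)b²`; the first
term integrates to at most `(1+τ)(π/L)² · L/2` (`∫₀ᴸ cos² = L/2`), the second lives on the two
ramps of width `ε`, where `|sin(πt/L)| ≤ πε/L` cancels the `ε⁻¹` of `q'`, so it contributes
`≤ (1+τ⁻¹)(π/L)²D² · 2ε`; and `∫ f² ≥ ∫_ε^{L-ε} sin² ≥ L/2 - ε`. Choosing `τ` and then `ε` small
gives the claim. All `[folklore]`.

## References

* [LSSY2005] E. H. Lieb, R. Seiringer, J. P. Solovej, J. Yngvason, *The Mathematics of the Bose Gas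
  and its Condensation* (2005), Ch. 2 (box energies; the free value `π²/L²` per direction).
-/

noncomputable section

namespace Summit.AtomisticToContinuum.BoseEinsteinCondensation.Theorems.BaseCoherentMass

open MeasureTheory Set
open scoped ENNReal
open Literature.Analysis.Calculus

/-! ### Elementary inequalities -/

/-- Young's inequality with a parameter: `(a+b)² ≤ (1+τ)a² + (1+τ⁻¹)b²` for `τ > 0`. [folklore] -/
theorem freeUpperBound_young {τ : ℝ} (hτ : 0 < τ) (a b : ℝ) :
    (a + b) ^ 2 ≤ (1 + τ) * a ^ 2 + (1 + τ⁻¹) * b ^ 2 := by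
  have hτ0 : τ ≠ 0 := hτ.ne'
  have key : (1 + τ) * a ^ 2 + (1 + τ⁻¹) * b ^ 2 - (a + b) ^ 2 = τ⁻¹ * (τ * a - b) ^ 2 := by
    field_simp
    ring
  nlinarith [key, mul_nonneg (inv_nonneg.2 hτ.le) (sq_nonneg (τ * a - b))]

/-- On the two ramps `[0, ε] ∪ [L-ε, L]` the sine mode is small: `sin²(πt/L) ≤ (πε/L)²`
(`|sin x| ≤ |x|` and `sin(πt/L) = sin(π(L-t)/L)`). [folklore] -/
theorem freeUpperBound_sin_sq_le {L ε t : ℝ} (hL : 0 < L)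
    (ht : t ∈ Set.Icc 0 ε ∪ Set.Icc (L - ε) L) :
    Real.sin (Real.pi / L * t) ^ 2 ≤ (Real.pi / L * ε) ^ 2 := by
  have hω : 0 ≤ Real.pi / L := by positivity
  rcases ht with ht | ht
  · calc Real.sin (Real.pi / L * t) ^ 2 ≤ (Real.pi / L * t) ^ 2 := Real.sin_sq_le_sq
      _ ≤ (Real.pi / L * ε) ^ 2 :=
          pow_le_pow_left₀ (mul_nonneg hω ht.1) (mul_le_mul_of_nonneg_left ht.2 hω) 2
  · have hrw : Real.pi / L * t = Real.pi - Real.pi / L * (L - t) := by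
      field_simp
      ring
    rw [hrw, Real.sin_pi_sub]
    calc Real.sin (Real.pi / L * (L - t)) ^ 2 ≤ (Real.pi / L * (L - t)) ^ 2 := Real.sin_sq_le_sq
      _ ≤ (Real.pi / L * ε) ^ 2 :=
          pow_le_pow_left₀ (mul_nonneg hω (by linarith [ht.2]))
            (mul_le_mul_of_nonneg_left (by linarith [ht.1]) hω) 2

/-- The argument `(t - L/2)/ε` of the plateau cut-off `cutoff (L/(2ε))`: it is `≥ L/(2ε)` in absolute
value off `(0, L)` (cut-off `= 0`), `≤ L/(2ε) - 1` on `[ε, L-ε]` (cut-off `= 1`) and `< L/(2ε) - 1` on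
`(ε, L-ε)` (derivative `= 0`). [folklore] -/
theorem freeUpperBound_cutoff_arg {L ε t : ℝ} (hε : 0 < ε) :
    (t ∉ Set.Ioo 0 L → L / (2 * ε) ≤ |(t - L / 2) / ε|) ∧
    (t ∈ Set.Icc ε (L - ε) → |(t - L / 2) / ε| ≤ L / (2 * ε) - 1) ∧
    (t ∈ Set.Ioo ε (L - ε) → |(t - L / 2) / ε| < L / (2 * ε) - 1) := by
  rw [abs_div, abs_of_pos hε]
  have h1 : L / (2 * ε) = (L / 2) / ε := by rw [div_div]
  have h2 : L / (2 * ε) - 1 = (L / 2 - ε) / ε := by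
    field_simp
  refine ⟨fun ht => ?_, fun ht => ?_, fun ht => ?_⟩
  · rw [h1]
    refine div_le_div_of_nonneg_right ?_ hε.le
    rw [Set.mem_Ioo, not_and_or, not_lt, not_lt] at ht
    rcases ht with ht | ht
    · exact le_abs'.2 (Or.inl (by linarith))
    · exact le_abs'.2 (Or.inr (by linarith))
  · rw [h2]
    refine div_le_div_of_nonneg_right ?_ hε.le
    rw [abs_le]
    constructor <;> linarith [ht.1, ht.2]
  · rw [h2]
    refine div_lt_div_of_pos_right ?_ hε
    rw [abs_lt]
    constructor <;> linarith [ht.1, ht.2]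

/-! ### The profile `f(t) = sin(πt/L) · cutoff_{L/(2ε)}((t - L/2)/ε)` and its derivative -/

/-- Product/chain rule for the cut-off sine profile. [folklore] -/
theorem freeUpperBound_hasDerivAt_profile (ω R ε c t : ℝ) :
    HasDerivAt (fun t => Real.sin (ω * t) * cutoff R ((t - c) / ε))
      (Real.cos (ω * t) * ω * cutoff R ((t - c) / ε) +
        Real.sin (ω * t) * (deriv (cutoff R) ((t - c) / ε) * (1 / ε))) t := by
  have h1 : HasDerivAt (fun t => Real.sin (ω * t)) (Real.cos (ω * t) * ω) t :=
    (hasDerivAt_const_mul ω).sin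
  have hc : HasDerivAt (cutoff R) (deriv (cutoff R) ((t - c) / ε)) ((t - c) / ε) :=
    ((contDiff_cutoff R (n := 1)).differentiable one_ne_zero _).hasDerivAt
  have h2 : HasDerivAt (fun t => cutoff R ((t - c) / ε))
      (deriv (cutoff R) ((t - c) / ε) * (1 / ε)) t := by
    have h := hc.comp t (((hasDerivAt_id t).sub_const c).div_const ε)
    exact h
  exact h1.mul h2

/-- **Pointwise bound on `f'²`.** With `|cutoff'| ≤ D`: `f'(t)² ≤ (1+τ)(π/L)² cos²(πt/L) 1_{[0,L]}(t)
+ (1+τ⁻¹)(π/L)² D² 1_{[0,ε]∪[L-ε,L]}(t)` (Young; `0 ≤ q ≤ 1`, `q = 0` off `(0,L)`; `q' = 0` on the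
plateau and off the box, `|sin| ≤ πε/L` and `|q'| ≤ D/ε` on the ramps). [folklore] -/
theorem freeUpperBound_deriv_sq_le {L ε τ D : ℝ} (hL : 0 < L) (hε : 0 < ε) (hτ : 0 < τ)
    (hD : ∀ R s, |deriv (cutoff R) s| ≤ D) (t : ℝ) :
    deriv (fun t => Real.sin (Real.pi / L * t) * cutoff (L / (2 * ε)) ((t - L / 2) / ε)) t ^ 2 ≤
      (1 + τ) * (Real.pi / L) ^ 2 *
          (Set.Icc 0 L).indicator (fun t => Real.cos (Real.pi / L * t) ^ 2) t +
        (1 + τ⁻¹) * ((Real.pi / L) ^ 2 * D ^ 2) *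
          (Set.Icc 0 ε ∪ Set.Icc (L - ε) L).indicator 1 t := by
  have harg := freeUpperBound_cutoff_arg (L := L) (t := t) hε
  rw [(freeUpperBound_hasDerivAt_profile (Real.pi / L) (L / (2 * ε)) ε (L / 2) t).deriv]
  set q : ℝ := cutoff (L / (2 * ε)) ((t - L / 2) / ε) with hq
  set q' : ℝ := deriv (cutoff (L / (2 * ε))) ((t - L / 2) / ε) with hq'
  -- the main term
  have ha : (Real.cos (Real.pi / L * t) * (Real.pi / L) * q) ^ 2 ≤
      (Real.pi / L) ^ 2 * (Set.Icc 0 L).indicator (fun t => Real.cos (Real.pi / L * t) ^ 2) t := by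
    by_cases ht : t ∈ Set.Icc 0 L
    · rw [Set.indicator_of_mem ht]
      have hq2 : q ^ 2 ≤ 1 := pow_le_one₀ (cutoff_nonneg _ _) (cutoff_le_one _ _)
      calc (Real.cos (Real.pi / L * t) * (Real.pi / L) * q) ^ 2
          = (Real.pi / L) ^ 2 * Real.cos (Real.pi / L * t) ^ 2 * q ^ 2 := by ring
        _ ≤ (Real.pi / L) ^ 2 * Real.cos (Real.pi / L * t) ^ 2 * 1 :=
            mul_le_mul_of_nonneg_left hq2 (by positivity)
        _ = (Real.pi / L) ^ 2 * Real.cos (Real.pi / L * t) ^ 2 := mul_one _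
    · have hnot : t ∉ Set.Ioo 0 L := fun h => ht (Set.Ioo_subset_Icc_self h)
      have hq0 : q = 0 := cutoff_eq_zero (harg.1 hnot)
      rw [Set.indicator_of_notMem ht, hq0, mul_zero, mul_zero]
      norm_num
  -- the ramp term
  have hb : (Real.sin (Real.pi / L * t) * (q' * (1 / ε))) ^ 2 ≤
      (Real.pi / L) ^ 2 * D ^ 2 * (Set.Icc 0 ε ∪ Set.Icc (L - ε) L).indicator 1 t := by
    have hRHS0 : 0 ≤ (Real.pi / L) ^ 2 * D ^ 2 * (Set.Icc 0 ε ∪ Set.Icc (L - ε) L).indicator 1 t :=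
      mul_nonneg (by positivity) (Set.indicator_nonneg (fun _ _ => zero_le_one) _)
    by_cases h1 : t ∈ Set.Ioo ε (L - ε)
    · have h0 : q' = 0 := deriv_cutoff_eq_zero_of_lt (harg.2.2 h1)
      rw [h0, zero_mul, mul_zero, zero_pow two_ne_zero]
      exact hRHS0
    by_cases h2 : t ∈ Set.Ioo 0 L
    · have hmem : t ∈ Set.Icc 0 ε ∪ Set.Icc (L - ε) L := by
        rw [Set.mem_Ioo, not_and_or, not_lt, not_lt] at h1
        rcases h1 with h1 | h1
        · exact Or.inl ⟨h2.1.le, h1⟩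
        · exact Or.inr ⟨h1, h2.2.le⟩
      rw [Set.indicator_of_mem hmem, Pi.one_apply, mul_one]
      have hsin := freeUpperBound_sin_sq_le (ε := ε) hL hmem
      have hq'2 : q' ^ 2 ≤ D ^ 2 := by
        rw [← sq_abs q']
        exact pow_le_pow_left₀ (abs_nonneg _) (hD _ _) 2
      calc (Real.sin (Real.pi / L * t) * (q' * (1 / ε))) ^ 2
          = Real.sin (Real.pi / L * t) ^ 2 * q' ^ 2 / ε ^ 2 := by ring
        _ ≤ (Real.pi / L * ε) ^ 2 * D ^ 2 / ε ^ 2 :=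
            div_le_div_of_nonneg_right (mul_le_mul hsin hq'2 (sq_nonneg _) (sq_nonneg _)) (sq_nonneg _)
        _ = (Real.pi / L) ^ 2 * D ^ 2 := by
            field_simp
    · have h0 : q' = 0 := deriv_cutoff_eq_zero_of_le (harg.1 h2)
      rw [h0, zero_mul, mul_zero, zero_pow two_ne_zero]
      exact hRHS0
  calc (Real.cos (Real.pi / L * t) * (Real.pi / L) * q + Real.sin (Real.pi / L * t) * (q' * (1 / ε))) ^ 2
      ≤ (1 + τ) * (Real.cos (Real.pi / L * t) * (Real.pi / L) * q) ^ 2 +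
          (1 + τ⁻¹) * (Real.sin (Real.pi / L * t) * (q' * (1 / ε))) ^ 2 := freeUpperBound_young hτ _ _
    _ ≤ (1 + τ) * ((Real.pi / L) ^ 2 * (Set.Icc 0 L).indicator (fun t => Real.cos (Real.pi / L * t) ^ 2) t) +
          (1 + τ⁻¹) * ((Real.pi / L) ^ 2 * D ^ 2 * (Set.Icc 0 ε ∪ Set.Icc (L - ε) L).indicator 1 t) :=
        add_le_add (mul_le_mul_of_nonneg_left ha (by positivity))
          (mul_le_mul_of_nonneg_left hb (by positivity))
    _ = _ := by ring

/-- `ofReal` of a real indicator is the `ℝ≥0∞` indicator of `ofReal`. [folklore] -/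
theorem freeUpperBound_ofReal_indicator (s : Set ℝ) (g : ℝ → ℝ) (t : ℝ) :
    ENNReal.ofReal (s.indicator g t) = s.indicator (fun t => ENNReal.ofReal (g t)) t := by
  by_cases ht : t ∈ s
  · rw [Set.indicator_of_mem ht, Set.indicator_of_mem ht]
  · rw [Set.indicator_of_notMem ht, Set.indicator_of_notMem ht, ENNReal.ofReal_zero]

/-- `ofReal` of the real indicator `1_s` is the `ℝ≥0∞` indicator `1_s`. [folklore] -/
theorem freeUpperBound_ofReal_indicator_one (s : Set ℝ) (t : ℝ) :
    ENNReal.ofReal (s.indicator 1 t) = s.indicator 1 t := by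
  by_cases ht : t ∈ s <;> simp [ht]

/-- The pointwise bound on `f'²` in `ℝ≥0∞` form, ready to be integrated. [folklore] -/
theorem freeUpperBound_ofReal_deriv_sq_le {L ε τ D : ℝ} (hL : 0 < L) (hε : 0 < ε) (hτ : 0 < τ)
    (hD : ∀ R s, |deriv (cutoff R) s| ≤ D) (t : ℝ) :
    ENNReal.ofReal
        (deriv (fun t => Real.sin (Real.pi / L * t) * cutoff (L / (2 * ε)) ((t - L / 2) / ε)) t ^ 2) ≤
      ENNReal.ofReal ((1 + τ) * (Real.pi / L) ^ 2) *
          (Set.Icc 0 L).indicator (fun t => ENNReal.ofReal (Real.cos (Real.pi / L * t) ^ 2)) t +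
        ENNReal.ofReal ((1 + τ⁻¹) * ((Real.pi / L) ^ 2 * D ^ 2)) *
          (Set.Icc 0 ε ∪ Set.Icc (L - ε) L).indicator 1 t := by
  refine (ENNReal.ofReal_le_ofReal (freeUpperBound_deriv_sq_le hL hε hτ hD t)).trans (le_of_eq ?_)
  have hi₁ : 0 ≤ (Set.Icc 0 L).indicator (fun t => Real.cos (Real.pi / L * t) ^ 2) t :=
    Set.indicator_nonneg (fun _ _ => sq_nonneg _) _
  have hi₂ : 0 ≤ (Set.Icc 0 ε ∪ Set.Icc (L - ε) L).indicator (1 : ℝ → ℝ) t :=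
    Set.indicator_nonneg (fun _ _ => zero_le_one) _
  rw [ENNReal.ofReal_add (mul_nonneg (by positivity) hi₁) (mul_nonneg (by positivity) hi₂),
    ENNReal.ofReal_mul (p := (1 + τ) * (Real.pi / L) ^ 2) (by positivity),
    ENNReal.ofReal_mul (p := (1 + τ⁻¹) * ((Real.pi / L) ^ 2 * D ^ 2)) (by positivity),
    freeUpperBound_ofReal_indicator, freeUpperBound_ofReal_indicator_one]

/-! ### The two trigonometric integrals -/

/-- `∫₀ᴸ cos²(πt/L) dt = L/2`. [folklore] -/
theorem freeUpperBound_setLIntegral_cos_sq {L : ℝ} (hL : 0 < L) :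
    ∫⁻ t in Set.Icc 0 L, ENNReal.ofReal (Real.cos (Real.pi / L * t) ^ 2) = ENNReal.ofReal (L / 2) := by
  have hint : IntegrableOn (fun t => Real.cos (Real.pi / L * t) ^ 2) (Set.Icc 0 L) :=
    (by fun_prop : Continuous fun t => Real.cos (Real.pi / L * t) ^ 2).integrableOn_Icc
  rw [← ofReal_integral_eq_lintegral_ofReal hint (ae_of_all _ fun t => sq_nonneg _)]
  congr 1
  rw [integral_Icc_eq_integral_Ioc, ← intervalIntegral.integral_of_le hL.le,
    intervalIntegral.integral_comp_mul_left (fun x => Real.cos x ^ 2) (by positivity : Real.pi / L ≠ 0),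
    integral_cos_sq]
  have hb : Real.pi / L * L = Real.pi := by field_simp
  rw [mul_zero, hb, Real.cos_zero, Real.sin_zero, Real.sin_pi, smul_eq_mul]
  field_simp
  ring

/-- `∫_ε^{L-ε} sin²(πt/L) dt ≥ L/2 - ε` for `0 ≤ ε ≤ L/2` (the exact value is
`L/2 - ε + (L/2π) sin(2πε/L)`). [folklore] -/
theorem freeUpperBound_le_setLIntegral_sin_sq {L ε : ℝ} (hL : 0 < L) (hε : 0 ≤ ε) (hεL : ε ≤ L / 2) :
    ENNReal.ofReal (L / 2 - ε) ≤
      ∫⁻ t in Set.Icc ε (L - ε), ENNReal.ofReal (Real.sin (Real.pi / L * t) ^ 2) := by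
  have hint : IntegrableOn (fun t => Real.sin (Real.pi / L * t) ^ 2) (Set.Icc ε (L - ε)) :=
    (by fun_prop : Continuous fun t => Real.sin (Real.pi / L * t) ^ 2).integrableOn_Icc
  rw [← ofReal_integral_eq_lintegral_ofReal hint (ae_of_all _ fun t => sq_nonneg _)]
  refine ENNReal.ofReal_le_ofReal ?_
  rw [integral_Icc_eq_integral_Ioc, ← intervalIntegral.integral_of_le (by linarith : ε ≤ L - ε),
    intervalIntegral.integral_comp_mul_left (fun x => Real.sin x ^ 2) (by positivity : Real.pi / L ≠ 0),
    integral_sin_sq]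
  set a := Real.pi / L * ε with ha
  have hb : Real.pi / L * (L - ε) = Real.pi - a := by rw [ha]; field_simp
  rw [hb, Real.sin_pi_sub, Real.cos_pi_sub, smul_eq_mul]
  have ha0 : 0 ≤ a := by positivity
  have ha1 : a ≤ Real.pi / 2 := by
    rw [ha]
    calc Real.pi / L * ε ≤ Real.pi / L * (L / 2) := by gcongr
      _ = Real.pi / 2 := by field_simp
  have hsin : 0 ≤ Real.sin a := Real.sin_nonneg_of_nonneg_of_le_pi ha0 (by linarith [Real.pi_pos])
  have hcos : 0 ≤ Real.cos a :=
    Real.cos_nonneg_of_neg_pi_div_two_le_of_le (by linarith [Real.pi_pos]) ha1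
  have hsc : 0 ≤ Real.sin a * Real.cos a := mul_nonneg hsin hcos
  have hω : 0 < (Real.pi / L)⁻¹ := by positivity
  calc L / 2 - ε = (Real.pi / L)⁻¹ * ((Real.pi - a - a) / 2) := by rw [ha]; field_simp; ring
    _ ≤ (Real.pi / L)⁻¹ *
        ((Real.sin a * Real.cos a - Real.sin a * -Real.cos a + (Real.pi - a) - a) / 2) := by
        gcongr
        nlinarith

/-- The two ramps have total length at most `2ε`. [folklore] -/
theorem freeUpperBound_volume_ramps_le {L ε : ℝ} (hε : 0 ≤ ε) :
    volume (Set.Icc 0 ε ∪ Set.Icc (L - ε) L) ≤ ENNReal.ofReal (2 * ε) := by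
  calc volume (Set.Icc 0 ε ∪ Set.Icc (L - ε) L)
      ≤ volume (Set.Icc 0 ε) + volume (Set.Icc (L - ε) L) := measure_union_le _ _
    _ = ENNReal.ofReal (ε - 0) + ENNReal.ofReal (L - (L - ε)) := by rw [Real.volume_Icc, Real.volume_Icc]
    _ = ENNReal.ofReal (2 * ε) := by
        rw [← ENNReal.ofReal_add (by linarith) (by linarith)]
        congr 1
        ring

/-! ### The registered sub-goal: the one-dimensional profile -/

/-- **One-dimensional cut-off sine profile (sub-goal of `stub_freeUpperBound`).** For every `L > 0`
and `η > 0` there is `f ∈ C¹(ℝ)` vanishing off `(0, L)` with `0 < ∫ f² < ∞` and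
`∫ f'² ≤ (π²/L² + η) ∫ f²`: the sine mode `sin(πt/L)` smoothly cut off on ramps of width `ε` near the
end points, `ε` small with `η`. [folklore] -/
theorem stub_freeUpperBound_profile : ∀ (L : ℝ), 0 < L → ∀ (η : ℝ), 0 < η →
    ∃ f : ℝ → ℝ, ContDiff ℝ 1 f ∧ (∀ t, t ∉ Set.Ioo 0 L → f t = 0) ∧
      (∫⁻ t, ENNReal.ofReal (f t ^ 2)) ≠ 0 ∧ (∫⁻ t, ENNReal.ofReal (f t ^ 2)) ≠ ⊤ ∧
      ∫⁻ t, ENNReal.ofReal (deriv f t ^ 2) ≤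
        ENNReal.ofReal (Real.pi ^ 2 / L ^ 2 + η) * ∫⁻ t, ENNReal.ofReal (f t ^ 2) := by
  intro L hL η hη
  obtain ⟨D, hD0, hD⟩ := exists_bound_deriv_cutoff
  have hω0 : 0 < Real.pi / L := by positivity
  have hω2 : (Real.pi / L) ^ 2 = Real.pi ^ 2 / L ^ 2 := by rw [div_pow]
  -- the Young parameter `τ` and the ramp width `ε`
  set τ : ℝ := η / (2 * (Real.pi / L) ^ 2) with hτ
  have hτ0 : 0 < τ := by positivity
  have hc₁ : (1 + τ) * (Real.pi / L) ^ 2 = (Real.pi / L) ^ 2 + η / 2 := by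
    rw [hτ]
    field_simp
  set c₂ : ℝ := (1 + τ⁻¹) * ((Real.pi / L) ^ 2 * D ^ 2) with hc₂
  have hc₂0 : 0 ≤ c₂ := by positivity
  have hden : 0 < 2 * c₂ + (Real.pi / L) ^ 2 + η := by positivity
  set ε : ℝ := min (L / 4) (η * L / 4 / (2 * c₂ + (Real.pi / L) ^ 2 + η)) with hε
  have hε0 : 0 < ε := lt_min (by positivity) (by positivity)
  have hεL4 : ε ≤ L / 4 := min_le_left _ _
  have hεL2 : ε ≤ L / 2 := by linarith
  have hεkey : ε * (2 * c₂ + (Real.pi / L) ^ 2 + η) ≤ η * L / 4 :=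
    (le_div_iff₀ hden).1 (min_le_right _ _)
  have harg := fun t : ℝ => freeUpperBound_cutoff_arg (L := L) (t := t) hε0
  -- the profile
  set f : ℝ → ℝ := fun t => Real.sin (Real.pi / L * t) * cutoff (L / (2 * ε)) ((t - L / 2) / ε) with hf
  -- lower bound for `∫ f²`
  have hlowA : ENNReal.ofReal (L / 2 - ε) ≤ ∫⁻ t, ENNReal.ofReal (f t ^ 2) := by
    calc ENNReal.ofReal (L / 2 - ε)
        ≤ ∫⁻ t in Set.Icc ε (L - ε), ENNReal.ofReal (Real.sin (Real.pi / L * t) ^ 2) :=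
          freeUpperBound_le_setLIntegral_sin_sq hL hε0.le hεL2
      _ = ∫⁻ t in Set.Icc ε (L - ε), ENNReal.ofReal (f t ^ 2) := by
          refine setLIntegral_congr_fun measurableSet_Icc (fun t ht => ?_)
          simp only [hf, cutoff_eq_one ((harg t).2.1 ht), mul_one]
      _ ≤ ∫⁻ t, ENNReal.ofReal (f t ^ 2) := setLIntegral_le_lintegral _ _
  have hLε : 0 < L / 2 - ε := by linarith
  refine ⟨f, ?_, ?_, ?_, ?_, ?_⟩
  · -- `C¹`
    simp only [hf]
    exact (Real.contDiff_sin.comp (contDiff_const.mul contDiff_id)).mul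
      ((contDiff_cutoff _).comp ((contDiff_id.sub contDiff_const).div_const ε))
  · -- support
    intro t ht
    simp only [hf, cutoff_eq_zero ((harg t).1 ht), mul_zero]
  · -- `∫ f² ≠ 0`
    intro hA
    rw [hA, nonpos_iff_eq_zero, ENNReal.ofReal_eq_zero] at hlowA
    linarith
  · -- `∫ f² < ∞`
    refine ne_top_of_le_ne_top (measure_Icc_lt_top (μ := (volume : Measure ℝ)) (a := 0) (b := L)).ne ?_
    rw [← lintegral_indicator_one measurableSet_Icc]
    refine lintegral_mono fun t => ?_
    by_cases ht : t ∈ Set.Icc 0 L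
    · rw [Set.indicator_of_mem ht, Pi.one_apply]
      refine ENNReal.ofReal_le_one.2 ?_
      simp only [hf]
      rw [mul_pow]
      exact mul_le_one₀ (Real.sin_sq_le_one _) (sq_nonneg _)
        (pow_le_one₀ (cutoff_nonneg _ _) (cutoff_le_one _ _))
    · have hnot : t ∉ Set.Ioo 0 L := fun h => ht (Set.Ioo_subset_Icc_self h)
      simp only [hf, cutoff_eq_zero ((harg t).1 hnot), mul_zero, Set.indicator_of_notMem ht]
      simp
  · -- the Rayleigh quotient
    have hmeas₁ : Measurable fun t =>
        (Set.Icc 0 L).indicator (fun t => ENNReal.ofReal (Real.cos (Real.pi / L * t) ^ 2)) t :=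
      (ENNReal.measurable_ofReal.comp
        (by fun_prop : Measurable fun t => Real.cos (Real.pi / L * t) ^ 2)).indicator measurableSet_Icc
    have hmeas₂ : Measurable fun t => (Set.Icc 0 ε ∪ Set.Icc (L - ε) L).indicator (1 : ℝ → ℝ≥0∞) t :=
      measurable_one.indicator (measurableSet_Icc.union measurableSet_Icc)
    have hreal : (1 + τ) * (Real.pi / L) ^ 2 * (L / 2) + c₂ * (2 * ε) ≤
        (Real.pi ^ 2 / L ^ 2 + η) * (L / 2 - ε) := by
      rw [hc₁, ← hω2]
      nlinarith [hεkey, hω0]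
    calc ∫⁻ t, ENNReal.ofReal (deriv f t ^ 2)
        ≤ ∫⁻ t, (ENNReal.ofReal ((1 + τ) * (Real.pi / L) ^ 2) *
            (Set.Icc 0 L).indicator (fun t => ENNReal.ofReal (Real.cos (Real.pi / L * t) ^ 2)) t +
          ENNReal.ofReal c₂ * (Set.Icc 0 ε ∪ Set.Icc (L - ε) L).indicator 1 t) :=
          lintegral_mono fun t => freeUpperBound_ofReal_deriv_sq_le hL hε0 hτ0 hD t
      _ = ENNReal.ofReal ((1 + τ) * (Real.pi / L) ^ 2) *
            (∫⁻ t, (Set.Icc 0 L).indicator (fun t => ENNReal.ofReal (Real.cos (Real.pi / L * t) ^ 2)) t) +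
          ENNReal.ofReal c₂ * ∫⁻ t, (Set.Icc 0 ε ∪ Set.Icc (L - ε) L).indicator 1 t := by
          rw [lintegral_add_left (hmeas₁.const_mul _), lintegral_const_mul _ hmeas₁,
            lintegral_const_mul _ hmeas₂]
      _ = ENNReal.ofReal ((1 + τ) * (Real.pi / L) ^ 2) * ENNReal.ofReal (L / 2) +
          ENNReal.ofReal c₂ * volume (Set.Icc 0 ε ∪ Set.Icc (L - ε) L) := by
          rw [lintegral_indicator measurableSet_Icc, freeUpperBound_setLIntegral_cos_sq hL,
            lintegral_indicator_one (measurableSet_Icc.union measurableSet_Icc)]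
      _ ≤ ENNReal.ofReal ((1 + τ) * (Real.pi / L) ^ 2) * ENNReal.ofReal (L / 2) +
          ENNReal.ofReal c₂ * ENNReal.ofReal (2 * ε) := by
          gcongr
          exact freeUpperBound_volume_ramps_le hε0.le
      _ = ENNReal.ofReal ((1 + τ) * (Real.pi / L) ^ 2 * (L / 2) + c₂ * (2 * ε)) := by
          rw [ENNReal.ofReal_add (by positivity) (by positivity),
            ENNReal.ofReal_mul (p := (1 + τ) * (Real.pi / L) ^ 2) (by positivity),
            ENNReal.ofReal_mul (p := c₂) hc₂0]
      _ ≤ ENNReal.ofReal ((Real.pi ^ 2 / L ^ 2 + η) * (L / 2 - ε)) := ENNReal.ofReal_le_ofReal hreal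
      _ = ENNReal.ofReal (Real.pi ^ 2 / L ^ 2 + η) * ENNReal.ofReal (L / 2 - ε) :=
          ENNReal.ofReal_mul (by positivity)
      _ ≤ ENNReal.ofReal (Real.pi ^ 2 / L ^ 2 + η) * ∫⁻ t, ENNReal.ofReal (f t ^ 2) :=
          mul_le_mul_right hlowA _

end Summit.AtomisticToContinuum.BoseEinsteinCondensation.Theorems.BaseCoherentMass

end
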